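import Summits.Ventures.LatticeQCDFlow.Exactness.Phi4MetropolisSiteInvolution
import HarnessLib

/-!
# The SIGN RULE for the local arm: the single-site Metropolis acceptance is
# `P(ΔS_x ≤ 0) + P(ΔS_x < 0)` in equilibrium — every action, every even step law, every volume

HONEST FRAMING: exact (Metropolis-corrected) sampling algorithms for lattice gauge theory;
figures of merit are autocorrelation/cost numbers at stated couplings and volumes; no
continuum-physics claim.  (SCALAR calibration rung S0-A: not a gauge result.)

Venture `LatticeQCDFlow` (cell pub-lqcd), topic `Exactness`; FANOUT row 2 (`s0-phi4`, LOCAL arm: the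
acceptance column of the site-update engine and the battery's cheap consistency checks).  NEW WORK
of the cell — the local-arm twin of `Phi4HMCFluctuationRelation.hmc_acceptance_eq` (HMC arm),
`PTBCSwapSignRule` (replica exchange) and this session's `IMHAcceptanceWeightOrder` (flow arm): row
2's `Phi4MetropolisSiteInvolution` typed the site update as a VOLUME-PRESERVING INVOLUTION
`Ψ_x(u, φ) = (−u, φ + u e_x)` of `ℝ × ℝ^Λ` with `e^{−H} = e^{−S(φ)}ρ(u)` and `ΔH = ΔS_x`, so
`Phi4HMCFluctuationRelation.acceptance_integral_eq` applies verbatim.  Nothing is cited as a fact; no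
definition is introduced.

## What is proved (`S` measurable with `e^{−S}` integrable; `ρ > 0` measurable, even, `∫ ρ = 1`;
`ΔS_x(u, φ) = S(φ + u e_x) − S(φ)`; weights `e^{−S(φ)}ρ(u)` on `ℝ × ℝ^Λ`)

* **`metropolisSite_acceptance_eq_signProb`** —
  `∫∫ min(1, e^{−ΔS_x}) ρ e^{−S} = ∫∫ 𝟙[ΔS_x ≤ 0] ρ e^{−S} + ∫∫ 𝟙[ΔS_x < 0] ρ e^{−S}`;
* **`metropolisSite_two_mul_decreaseProb_le_acceptance`** — the one-sided consequence that needs no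
  statement about ties: `2·∫∫ 𝟙[ΔS_x < 0] ρ e^{−S} ≤ ∫∫ min(1, e^{−ΔS_x}) ρ e^{−S}`;
* lattice φ⁴ (`λ > 0`, real `J`, every site, every positive even `ρ`):
  **`phi4MetropolisSite_acceptance_eq_signProb`**, **`phi4MetropolisSite_two_mul_decreaseProb_le_acceptance`**.

Reading for S0-A and the battery (no numerics implied): on the local arm the per-site acceptance
column and the sign statistics of the proposed action changes must satisfy
`acc_x = frac(ΔS_x ≤ 0) + frac(ΔS_x < 0)` up to statistics (`= 2·frac(ΔS_x < 0)` when the recorded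
`ΔS_x` has no ties, as for any continuous step law and a polynomial action), site by site and hence
for the sweep average — a check that costs one comparison per proposal and that a wrongly signed
`ΔS`, a non-symmetric step law or a missing `min(1, ·)` fails.  Exact companion on one Gaussian mode:
`GaussianMetropolisSiteAcceptance` (`acc = (2/π)·arctan(2√a/√v)`).  NOT CLAIMED: any value for any
run; that ties are null for a given `(S, ρ)`; anything about autocorrelations.
-/

namespace Summit.Ventures.LatticeQCDFlow.Exactness

open Real MeasureTheory Filter Set
open Summit.Ventures.LatticeQCDFlow.Scoring

variable {n : ℕ}

/-- **THE SIGN RULE FOR THE SINGLE-SITE METROPOLIS UPDATE, GENERAL ACTION**: `S` measurable with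
`e^{−S}` integrable, `ρ > 0` even and measurable with `∫ ρ = 1`; for every site `x`, with
`ΔS_x(u, φ) = S(φ + u e_x) − S(φ)`:
`∫∫ min(1, e^{−ΔS_x}) ρ(u) e^{−S(φ)} = ∫∫ 𝟙[ΔS_x ≤ 0] ρ e^{−S} + ∫∫ 𝟙[ΔS_x < 0] ρ e^{−S}`
— the equilibrium acceptance of the site update is the probability that the proposed move does not
raise the action plus the probability that it strictly lowers it (`= 2P(ΔS_x < 0) + P(ΔS_x = 0)`). -/
theorem metropolisSite_acceptance_eq_signProb {S : (Fin (n + 1) → ℝ) → ℝ} (hSm : Measurable S)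
    (hSi : Integrable (fun φ => Real.exp (-S φ))) {ρ : ℝ → ℝ} (hρ0 : ∀ u, 0 < ρ u)
    (hρm : Measurable ρ) (hρs : ∀ u, ρ (-u) = ρ u) (hρ1 : ∫ u, ρ u = 1) (x : Fin (n + 1)) :
    ∫ p, min 1 (Real.exp (-(S (p.2 + Pi.single x p.1) - S p.2))) * (Real.exp (-S p.2) * ρ p.1)
        ∂((volume : Measure ℝ).prod (volume : Measure (Fin (n + 1) → ℝ)))
      = (∫ p, (if S (p.2 + Pi.single x p.1) - S p.2 ≤ 0 then (1 : ℝ) else 0) * (Real.exp (-S p.2) * ρ p.1)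
          ∂((volume : Measure ℝ).prod (volume : Measure (Fin (n + 1) → ℝ))))
        + ∫ p, (if S (p.2 + Pi.single x p.1) - S p.2 < 0 then (1 : ℝ) else 0) * (Real.exp (-S p.2) * ρ p.1)
          ∂((volume : Measure ℝ).prod (volume : Measure (Fin (n + 1) → ℝ))) := by
  set μ2 : Measure (ℝ × (Fin (n + 1) → ℝ)) :=
    (volume : Measure ℝ).prod (volume : Measure (Fin (n + 1) → ℝ)) with hμ2
  set H : ℝ × (Fin (n + 1) → ℝ) → ℝ := fun q => S q.2 - Real.log (ρ q.1) with hH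
  set Ψ : ℝ × (Fin (n + 1) → ℝ) → ℝ × (Fin (n + 1) → ℝ) := fun q => (-q.1, q.2 + Pi.single x q.1) with hΨ
  have hHm : Measurable H := (hSm.comp measurable_snd).sub ((Real.measurable_log.comp hρm).comp measurable_fst)
  have hexpH : ∀ q, Real.exp (-H q) = Real.exp (-S q.2) * ρ q.1 := fun q => exp_neg_H_site S hρ0 q
  have hρi : Integrable ρ := by
    by_contra h
    rw [integral_undef h] at hρ1
    exact zero_ne_one hρ1
  have hw : Integrable (fun q => Real.exp (-H q)) μ2 := by
    simp_rw [hexpH]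
    have h := (hρi.mul_prod hSi : Integrable (fun q : ℝ × (Fin (n + 1) → ℝ) => ρ q.1 * Real.exp (-S q.2)) μ2)
    exact h.congr (Eventually.of_forall fun q => by ring)
  have hΔH : ∀ q, deltaH H Ψ q = S (q.2 + Pi.single x q.1) - S q.2 := fun q => deltaH_site_eq S hρs x q
  have key := acceptance_integral_eq hHm (measurable_siteShear x) (siteShear_involutive x)
    (measurePreserving_siteShear x) hw
  have e0 : ∫ q, min 1 (Real.exp (-deltaH H Ψ q)) * Real.exp (-H q) ∂μ2
      = ∫ q, min 1 (Real.exp (-(S (q.2 + Pi.single x q.1) - S q.2))) * (Real.exp (-S q.2) * ρ q.1) ∂μ2 :=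
    integral_congr_ae (Eventually.of_forall fun q => by simp only [hΔH, hexpH])
  have e1 : ∫ q, (if deltaH H Ψ q ≤ 0 then (1 : ℝ) else 0) * Real.exp (-H q) ∂μ2
      = ∫ q, (if S (q.2 + Pi.single x q.1) - S q.2 ≤ 0 then (1 : ℝ) else 0) * (Real.exp (-S q.2) * ρ q.1) ∂μ2 :=
    integral_congr_ae (Eventually.of_forall fun q => by simp only [hΔH, hexpH])
  have e2 : ∫ q, (if deltaH H Ψ q < 0 then (1 : ℝ) else 0) * Real.exp (-H q) ∂μ2
      = ∫ q, (if S (q.2 + Pi.single x q.1) - S q.2 < 0 then (1 : ℝ) else 0) * (Real.exp (-S q.2) * ρ q.1) ∂μ2 :=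
    integral_congr_ae (Eventually.of_forall fun q => by simp only [hΔH, hexpH])
  rw [e0, e1, e2] at key
  exact key

/-- **Corollary — the acceptance is at least twice the strict-decrease probability**:
`2·∫∫ 𝟙[ΔS_x < 0] ρ e^{−S} ≤ ∫∫ min(1, e^{−ΔS_x}) ρ e^{−S}` (with equality when ties are null). -/
theorem metropolisSite_two_mul_decreaseProb_le_acceptance {S : (Fin (n + 1) → ℝ) → ℝ} (hSm : Measurable S)
    (hSi : Integrable (fun φ => Real.exp (-S φ))) {ρ : ℝ → ℝ} (hρ0 : ∀ u, 0 < ρ u)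
    (hρm : Measurable ρ) (hρs : ∀ u, ρ (-u) = ρ u) (hρ1 : ∫ u, ρ u = 1) (x : Fin (n + 1)) :
    2 * ∫ p, (if S (p.2 + Pi.single x p.1) - S p.2 < 0 then (1 : ℝ) else 0) * (Real.exp (-S p.2) * ρ p.1)
          ∂((volume : Measure ℝ).prod (volume : Measure (Fin (n + 1) → ℝ)))
      ≤ ∫ p, min 1 (Real.exp (-(S (p.2 + Pi.single x p.1) - S p.2))) * (Real.exp (-S p.2) * ρ p.1)
          ∂((volume : Measure ℝ).prod (volume : Measure (Fin (n + 1) → ℝ))) := by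
  rw [metropolisSite_acceptance_eq_signProb hSm hSi hρ0 hρm hρs hρ1 x, two_mul]
  refine add_le_add ?_ le_rfl
  -- pointwise `𝟙[Δ < 0] ≤ 𝟙[Δ ≤ 0]`, against the nonnegative weight
  have hρi : Integrable ρ := by
    by_contra h
    rw [integral_undef h] at hρ1
    exact zero_ne_one hρ1
  have hwq : Integrable (fun p : ℝ × (Fin (n + 1) → ℝ) => Real.exp (-S p.2) * ρ p.1)
      ((volume : Measure ℝ).prod (volume : Measure (Fin (n + 1) → ℝ))) := by
    have h := (hρi.mul_prod hSi : Integrable (fun q : ℝ × (Fin (n + 1) → ℝ) => ρ q.1 * Real.exp (-S q.2))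
      ((volume : Measure ℝ).prod (volume : Measure (Fin (n + 1) → ℝ))))
    exact h.congr (Eventually.of_forall fun q => by ring)
  have hΔm : Measurable fun p : ℝ × (Fin (n + 1) → ℝ) => S (p.2 + Pi.single x p.1) - S p.2 :=
    (hSm.comp (measurable_snd.add (measurable_single_fst x))).sub (hSm.comp measurable_snd)
  have hwm : Measurable fun p : ℝ × (Fin (n + 1) → ℝ) => Real.exp (-S p.2) * ρ p.1 :=
    (Real.measurable_exp.comp (hSm.comp measurable_snd).neg).mul (hρm.comp measurable_fst)
  have hbdd : ∀ (c : ℝ × (Fin (n + 1) → ℝ) → Prop) [DecidablePred c], (Measurable fun p => if c p then (1 : ℝ) else 0) →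
      Integrable (fun p : ℝ × (Fin (n + 1) → ℝ) => (if c p then (1 : ℝ) else 0) * (Real.exp (-S p.2) * ρ p.1))
        ((volume : Measure ℝ).prod (volume : Measure (Fin (n + 1) → ℝ))) := by
    intro c _ hc
    refine hwq.mono' (hc.mul hwm).aestronglyMeasurable (Eventually.of_forall fun p => ?_)
    have h0 : 0 ≤ Real.exp (-S p.2) * ρ p.1 := mul_nonneg (Real.exp_pos _).le (hρ0 _).le
    rw [Real.norm_eq_abs, abs_of_nonneg (mul_nonneg (by split_ifs <;> norm_num) h0)]
    exact mul_le_of_le_one_left h0 (by split_ifs <;> norm_num)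
  refine integral_mono (hbdd _ (Measurable.ite (measurableSet_lt hΔm measurable_const) measurable_const
    measurable_const)) (hbdd _ (Measurable.ite (measurableSet_le hΔm measurable_const) measurable_const
    measurable_const)) fun p => ?_
  have h0 : 0 ≤ Real.exp (-S p.2) * ρ p.1 := mul_nonneg (Real.exp_pos _).le (hρ0 _).le
  refine mul_le_mul_of_nonneg_right ?_ h0
  split_ifs with h1 h2 <;> first | exact le_rfl | exact zero_le_one | exact absurd h1.le h2

/-- **LATTICE φ⁴** (`λ > 0`, real `J`, every site `x`, every positive even step density `ρ` with
`∫ ρ = 1`): the equilibrium acceptance of row 2's single-site Metropolis update equals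
`∫∫ 𝟙[ΔS_x ≤ 0] ρ e^{−S} + ∫∫ 𝟙[ΔS_x < 0] ρ e^{−S}`. -/
theorem phi4MetropolisSite_acceptance_eq_signProb {lam : ℝ} (hlam : 0 < lam)
    (J : Fin (n + 1) → Fin (n + 1) → ℝ) {ρ : ℝ → ℝ} (hρ0 : ∀ u, 0 < ρ u) (hρm : Measurable ρ)
    (hρs : ∀ u, ρ (-u) = ρ u) (hρ1 : ∫ u, ρ u = 1) (x : Fin (n + 1)) :
    ∫ p, min 1 (Real.exp (-(latticePhi4Action J lam (p.2 + Pi.single x p.1)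
          - latticePhi4Action J lam p.2))) * (gibbsWeight J lam p.2 * ρ p.1)
          ∂((volume : Measure ℝ).prod (volume : Measure (Fin (n + 1) → ℝ)))
      = (∫ p, (if latticePhi4Action J lam (p.2 + Pi.single x p.1) - latticePhi4Action J lam p.2 ≤ 0
            then (1 : ℝ) else 0) * (gibbsWeight J lam p.2 * ρ p.1)
          ∂((volume : Measure ℝ).prod (volume : Measure (Fin (n + 1) → ℝ))))
        + ∫ p, (if latticePhi4Action J lam (p.2 + Pi.single x p.1) - latticePhi4Action J lam p.2 < 0
            then (1 : ℝ) else 0) * (gibbsWeight J lam p.2 * ρ p.1)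
          ∂((volume : Measure ℝ).prod (volume : Measure (Fin (n + 1) → ℝ))) :=
  metropolisSite_acceptance_eq_signProb (continuous_latticePhi4Action J lam).measurable
    (integrable_gibbsWeight hlam J) hρ0 hρm hρs hρ1 x

/-- **LATTICE φ⁴, the one-sided test**: `2·∫∫ 𝟙[ΔS_x < 0] ρ e^{−S} ≤ ∫∫ min(1, e^{−ΔS_x}) ρ e^{−S}`. -/
theorem phi4MetropolisSite_two_mul_decreaseProb_le_acceptance {lam : ℝ} (hlam : 0 < lam)
    (J : Fin (n + 1) → Fin (n + 1) → ℝ) {ρ : ℝ → ℝ} (hρ0 : ∀ u, 0 < ρ u) (hρm : Measurable ρ)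
    (hρs : ∀ u, ρ (-u) = ρ u) (hρ1 : ∫ u, ρ u = 1) (x : Fin (n + 1)) :
    2 * ∫ p, (if latticePhi4Action J lam (p.2 + Pi.single x p.1) - latticePhi4Action J lam p.2 < 0
            then (1 : ℝ) else 0) * (gibbsWeight J lam p.2 * ρ p.1)
          ∂((volume : Measure ℝ).prod (volume : Measure (Fin (n + 1) → ℝ)))
      ≤ ∫ p, min 1 (Real.exp (-(latticePhi4Action J lam (p.2 + Pi.single x p.1)
          - latticePhi4Action J lam p.2))) * (gibbsWeight J lam p.2 * ρ p.1)
          ∂((volume : Measure ℝ).prod (volume : Measure (Fin (n + 1) → ℝ))) :=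
  metropolisSite_two_mul_decreaseProb_le_acceptance (continuous_latticePhi4Action J lam).measurable
    (integrable_gibbsWeight hlam J) hρ0 hρm hρs hρ1 x

end Summit.Ventures.LatticeQCDFlow.Exactness
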